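import Mathlib
import HarnessLib
import Literature.Probability.MarkovChains.ProductChainTensorisation
import Literature.Probability.MarkovChains.DensityDecomposition

/-!
# Product chains, II: `γ̃ = min_j w_jγ_j` EXACTLY — the lower bound `γ̃ ≥ min_j w_jγ_j` (Levin–Peres–Wilmer
# Cor. 12.13, the direction left open in `ProductChains.lean`)

HONEST FRAMING: exact (Metropolis-corrected) sampling algorithms for lattice gauge theory; figures
of merit are autocorrelation/cost numbers at stated couplings and volumes; no continuum-physics claim.

Conventions of `ProductChains.lean` (`prodKernel w P = P̃`, `tensorFun π = π̃`), `ProductChainTensorisation.lean`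
(`poincare_pair`, `lawVariance_tensorFun_cons`, `dirichletForm_prodKernel_cons`), `SpectralGapVariational.lean`
(`spectralGap`, Lemma 13.7, Remark 13.8), `DensityDecomposition.lean` (`le_spectralGapR_of_poincare`).
Source: D. A. Levin, Y. Peres (with E. L. Wilmer), *Markov Chains and Mixing Times*, 2nd ed., AMS 2017
[LevinPeres2017], §12.4 Corollary 12.13: for the product chain `P̃ = Σ_j w_j P̃_j` of reversible chains `P_j`
with spectral gaps `γ_j`, **`γ̃ = min_{1≤j≤d} w_jγ_j`**.  Everything is PROVED (finite sums; 0 named facts).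
DECLARED DEVIATION: induction on `d` with the two-factor tensorisation of the Poincaré inequality
(`ProductChainTensorisation.lean`) in place of the book's eigenbasis argument (Lemma 12.12 (ii)).

* **`prodKernel_poincare`** — if `c ≤ w_jγ_j` and `γ_j·Var_{π_j}(h) ≤ 𝓔_{π_j}(P_j; h)` for every `j`, `h`, then
  **`c·Var_π̃(f) ≤ 𝓔̃(f)`** for every `f` (any `d`, any non-negative weights);
* **COROLLARY 12.13, lower bound** `LevinPeres2017_cor_12_13_ge` — `min_j w_jγ_j ≤ γ̃` (`d ≥ 1`, positive `π_j`,
  reversible stochastic `P_j`, `|X_j| ≥ 2`, `w` a probability vector); with `ProductChains`'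
  `LevinPeres2017_cor_12_13_le_inf`: **`LevinPeres2017_cor_12_13` — `γ̃ = min_j w_jγ_j`**.

Context (cell pub-lqcd, venture LatticeQCDFlow): `n` sites updated one at a time with uniform site selection
relax EXACTLY `n` times slower than the slowest site (`γ̃ = γ_min/n`) — the converse of the volume law recorded
in `ProductChains.lean`.
-/

namespace Literature.Probability.MarkovChains

open Finset Matrix Function

universe u

/-! ## Tensorisation over `d` coordinates -/

/-- **TENSORISATION OF THE POINCARÉ INEQUALITY FOR THE PRODUCT CHAIN (12.22).**  If every coordinate chain
satisfies `γ_j·Var_{π_j}(h) ≤ 𝓔_{π_j}(P_j; h)` (probability vectors `π_j ≥ 0`, kernels `P_j ≥ 0`, weights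
`w_j ≥ 0`) and `c ≤ w_jγ_j` for all `j`, then **`c·Var_π̃(f) ≤ 𝓔̃(f)`** for every `f` on `Π_j X_j`.
[cite: LevinPeres2017, §12.4 Cor. 12.13 (the bound `γ̃ ≥ min_j w_jγ_j`, Poincaré form)] -/
theorem prodKernel_poincare (d : ℕ) {X : Fin d → Type u} [∀ j, Fintype (X j)] [∀ j, DecidableEq (X j)]
    {π : ∀ j, X j → ℝ} {P : ∀ j, X j → X j → ℝ} {w γ : Fin d → ℝ} {c : ℝ}
    (hπ0 : ∀ j u, 0 ≤ π j u) (hπ1 : ∀ j, ∑ u, π j u = 1) (hP0 : ∀ j u v, 0 ≤ P j u v)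
    (hw0 : ∀ j, 0 ≤ w j) (hc : ∀ j, c ≤ w j * γ j)
    (hgap : ∀ j, ∀ h : X j → ℝ, γ j * lawVariance (π j) h ≤ dirichletForm (π j) (P j) h)
    (f : (∀ j, X j) → ℝ) :
    c * lawVariance (tensorFun π) f ≤ dirichletForm (tensorFun π) (prodKernel w P) f := by
  induction d with
  | zero =>
    -- one-point space: the variance vanishes
    have hV : lawVariance (tensorFun π) f = 0 := by
      unfold lawVariance lawMean tensorFun
      simp
    rw [hV, mul_zero]
    exact dirichletForm_nonneg (fun x => Finset.prod_nonneg fun j _ => hπ0 j (x j))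
      (fun x y => sum_nonneg fun j _ => mul_nonneg (hw0 j) (coordKernel_nonneg P hP0 j x y)) f
  | succ d ih =>
    -- split off coordinate 0 and tensorise the pair (X 0, tail)
    have hA : ∀ h : X 0 → ℝ, c * lawVariance (π 0) h ≤ dirichletForm (π 0) (fun u v => w 0 * P 0 u v) h := by
      intro h
      rw [dirichletForm_const_mul_kernel]
      calc c * lawVariance (π 0) h ≤ w 0 * γ 0 * lawVariance (π 0) h :=
            mul_le_mul_of_nonneg_right (hc 0) (lawVariance_nonneg (hπ0 0) h)
        _ = w 0 * (γ 0 * lawVariance (π 0) h) := by ring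
        _ ≤ w 0 * dirichletForm (π 0) (P 0) h := mul_le_mul_of_nonneg_left (hgap 0 h) (hw0 0)
    have hB : ∀ g : (∀ i : Fin d, X i.succ) → ℝ,
        c * lawVariance (tensorFun (fun i : Fin d => π i.succ)) g
          ≤ dirichletForm (tensorFun (fun i : Fin d => π i.succ))
              (prodKernel (fun i : Fin d => w i.succ) (fun i : Fin d => P i.succ)) g :=
      ih (fun i => hπ0 i.succ) (fun i => hπ1 i.succ) (fun i => hP0 i.succ) (fun i => hw0 i.succ)
        (fun i => hc i.succ) (fun i => hgap i.succ)
    have htail0 : ∀ y : (∀ i : Fin d, X i.succ), 0 ≤ tensorFun (fun i : Fin d => π i.succ) y :=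
      fun y => Finset.prod_nonneg fun i _ => hπ0 i.succ (y i)
    have key := poincare_pair (hπ0 0) (hπ1 0) htail0 (sum_tensorFun_eq_one _ fun i => hπ1 i.succ)
      (QA := fun u v => w 0 * P 0 u v)
      (QB := prodKernel (fun i : Fin d => w i.succ) (fun i : Fin d => P i.succ))
      (fun u v => mul_nonneg (hw0 0) (hP0 0 u v))
      (fun y y₂ => sum_nonneg fun i _ => mul_nonneg (hw0 i.succ) (coordKernel_nonneg _ (fun i => hP0 i.succ) i y y₂))
      hA hB (fun u y => f (Fin.cons u y))
    rw [lawVariance_tensorFun_cons, dirichletForm_prodKernel_cons]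
    exact key

/-! ## Corollary 12.13: the lower bound and the equality -/

section Gap

variable {d : ℕ} {X : Fin d → Type u} [∀ j, Fintype (X j)] [∀ j, DecidableEq (X j)]
  {w : Fin d → ℝ} {P : ∀ j, X j → X j → ℝ} {π : ∀ j, X j → ℝ}

omit [∀ j, DecidableEq (X j)] in
/-- Each coordinate space is nonempty (its `π_j` has total mass `1`). [cite: LevinPeres2017, §12.4
(setting of Cor. 12.13)] -/
private theorem nonempty_coord' (hπ1 : ∀ j, ∑ u, π j u = 1) (j : Fin d) : Nonempty (X j) := by
  by_contra h
  rw [not_nonempty_iff] at h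
  have h1 := hπ1 j
  rw [univ_eq_empty, sum_empty] at h1
  exact zero_ne_one h1

/-- On a space with two points a positive probability vector gives some set mass in `(0, ½]`.
[cite: LevinPeres2017, §13.2.1 Remark 13.8 (a non-constant test function exists)] -/
private theorem exists_half_mass {Y : Type*} [Fintype Y] [Nontrivial Y] {μ : Y → ℝ} (hμ : ∀ x, 0 < μ x)
    (hμ1 : ∑ x, μ x = 1) : ∃ S : Finset Y, 0 < ∑ x ∈ S, μ x ∧ ∑ x ∈ S, μ x ≤ 1 / 2 := by
  classical
  obtain ⟨a, b, hab⟩ := exists_pair_ne Y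
  by_cases ha : μ a ≤ 1 / 2
  · exact ⟨{a}, by rw [sum_singleton]; exact hμ a, by rw [sum_singleton]; exact ha⟩
  · refine ⟨{b}, by rw [sum_singleton]; exact hμ b, ?_⟩
    rw [sum_singleton]
    have h2 : μ a + μ b ≤ ∑ x, μ x := by
      rw [← sum_pair hab]
      exact sum_le_sum_of_subset_of_nonneg (subset_univ _) fun x _ _ => (hμ x).le
    rw [hμ1] at h2
    rw [not_le] at ha
    linarith

/-- **COROLLARY 12.13, THE LOWER BOUND `γ̃ ≥ min_{1≤j≤d} w_jγ_j`** for the product chain (12.22) of reversible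
chains `P_j` (positive `π_j`, probability vector `w`, `d ≥ 1`, every `|X_j| ≥ 2`).
[cite: LevinPeres2017, §12.4 Cor. 12.13] -/
theorem LevinPeres2017_cor_12_13_ge [NeZero d] [∀ j, Nontrivial (X j)] (hw0 : ∀ j, 0 ≤ w j)
    (hw1 : ∑ j, w j = 1) (hP : ∀ j, IsRowStochastic (P j))
    (hDB : ∀ j, DetailedBalance (π j) (P j)) (hπ : ∀ j u, 0 < π j u)
    (hπ1 : ∀ j, ∑ u, π j u = 1) :
    univ.inf' univ_nonempty (fun j => w j * spectralGap (π j) (P j))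
      ≤ spectralGap (tensorFun π) (prodKernel w P) := by
  haveI : ∀ i, Nonempty (X i) := nonempty_coord' hπ1
  haveI : Nontrivial (∀ i, X i) := Pi.nontrivial_at (0 : Fin d)
  set c := univ.inf' univ_nonempty (fun j => w j * spectralGap (π j) (P j)) with hc
  have hpoin : ∀ f : (∀ j, X j) → ℝ,
      c * lawVariance (tensorFun π) f ≤ dirichletForm (tensorFun π) (prodKernel w P) f :=
    prodKernel_poincare d (γ := fun j => spectralGap (π j) (P j)) (fun j u => (hπ j u).le) hπ1
      (fun j => (hP j).1) hw0 (fun j => Finset.inf'_le _ (mem_univ j))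
      (fun j h => LevinPeres2017_remark_13_8 (hπ j) (hπ1 j) (hP j) (hDB j) h)
  have hπt := tensorFun_pos hπ
  have hπt1 := sum_tensorFun_eq_one π hπ1
  rw [LevinPeres2017_lemma_13_7 hπt hπt1 (prodKernel_isRowStochastic P w hw0 hw1 hP)
    (prodKernel_detailedBalance hDB w)]
  exact DensityDecomposition.le_spectralGapR_of_poincare hπt1 hpoin (exists_half_mass hπt hπt1)

/-- **COROLLARY 12.13: `γ̃ = min_{1≤j≤d} w_jγ_j`** (with `ProductChains.LevinPeres2017_cor_12_13_le_inf`).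
[cite: LevinPeres2017, §12.4 Cor. 12.13] -/
theorem LevinPeres2017_cor_12_13 [NeZero d] [∀ j, Nontrivial (X j)] (hw0 : ∀ j, 0 ≤ w j)
    (hw1 : ∑ j, w j = 1) (hP : ∀ j, IsRowStochastic (P j))
    (hDB : ∀ j, DetailedBalance (π j) (P j)) (hπ : ∀ j u, 0 < π j u)
    (hπ1 : ∀ j, ∑ u, π j u = 1) :
    spectralGap (tensorFun π) (prodKernel w P)
      = univ.inf' univ_nonempty (fun j => w j * spectralGap (π j) (P j)) :=
  le_antisymm (LevinPeres2017_cor_12_13_le_inf hw0 hw1 hP hDB hπ hπ1)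
    (LevinPeres2017_cor_12_13_ge hw0 hw1 hP hDB hπ hπ1)

end Gap

end Literature.Probability.MarkovChains
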